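import Summits.QuantumAdvantage.QuantumAdvantage.Theorems.WbwVerifiableLineNoSpeedup.Negative.PermInstances
import Mathlib.GroupTheory.Perm.Cycle.Basic

/-!
# Transpositions at distance `> T` stay in the long-cycle family

Sequel to `PermInstances.lean` (scaffolding for the remaining target `SvlAdversarySmallT` of the
crux `WhiteBoxWalk.WbwVerifiableLineNoSpeedup`, stmt-QuantumAdvantage-2239, work file
`Disproof.lean` §7.1). The adversary relation relates `σ` to `σ * swap u v` with `u = x_k` on the
line. CLOSURE (`noReturn_transpose`): if no point returns within `T` steps under `σ` and neither
`u` reaches `v` nor `v` reaches `u` within `T` steps, the same holds for `σ * swap u v` — covering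
BOTH partner types of §7.1: MERGE (`v` on another cycle, `noReturn_transpose_of_not_sameCycle`:
the reachability hypotheses are automatic) and SPLIT (both pieces of the split `0`-cycle longer
than `T`). Tools: `pow_transpose_eq_of_avoid` (before the orbit meets `{u,v}` the transposed
permutation iterates like `σ`) and `pow_transpose_after_hit` (after sitting at `u` it reads
`σ v, σ² v, …` while the `σ`-orbit of `v` avoids `{u,v}`) — these two are also the line formulas
behind the "acquire `≤ 2T`" count. Still NOT here: the counting injections themselves and the
four counts. Sorry-free.
-/

noncomputable section

set_option linter.dupNamespace false

namespace Summit.QuantumAdvantage.QuantumAdvantage.Theorems.WbwVerifiableLineNoSpeedup.Negative.PermInstances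

variable {m T : ℕ}

/-- Before the orbit hits `{u, v}`, `τ = transpose σ u v` iterates like `σ`. [folklore] -/
theorem pow_transpose_eq_of_avoid (σ : Equiv.Perm (Fin (2 ^ m))) (u v x : Fin (2 ^ m)) :
    ∀ j : ℕ, (∀ j' < j, (transpose σ u v ^ j') x ≠ u ∧ (transpose σ u v ^ j') x ≠ v) →
      (transpose σ u v ^ j) x = (σ ^ j) x := by
  intro j
  induction j with
  | zero => intro; rfl
  | succ j ih =>
    intro h
    have hj := ih fun j' hj' => h j' (by omega)
    obtain ⟨h1, h2⟩ := h j (by omega)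
    rw [pow_succ', Equiv.Perm.mul_apply, hj, pow_succ', Equiv.Perm.mul_apply]
    rw [hj] at h1 h2
    exact transpose_apply_of_ne σ h1 h2

/-- After the orbit sits at `u` at time `j₀`, it reads `σ v, σ² v, …` as long as the `σ`-orbit
of `v` avoids `{u, v}`. [folklore] -/
theorem pow_transpose_after_hit (σ : Equiv.Perm (Fin (2 ^ m))) {u v x : Fin (2 ^ m)} {j₀ : ℕ}
    (hhit : (transpose σ u v ^ j₀) x = u) {s : ℕ}
    (havoid : ∀ s', 1 ≤ s' → s' ≤ s → (σ ^ s') v ≠ u ∧ (σ ^ s') v ≠ v) :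
    ∀ s'', 1 ≤ s'' → s'' ≤ s + 1 → (transpose σ u v ^ (j₀ + s'')) x = (σ ^ s'') v := by
  intro s''
  induction s'' with
  | zero => intro h; omega
  | succ s'' ih =>
    intro _ hs
    rcases Nat.eq_zero_or_pos s'' with rfl | hpos
    · rw [show j₀ + (0 + 1) = j₀ + 1 by ring, pow_succ', Equiv.Perm.mul_apply, hhit,
        transpose_apply_left, zero_add, pow_one]
    · have hprev := ih hpos (by omega)
      rw [show j₀ + (s'' + 1) = (j₀ + s'') + 1 by ring, pow_succ', Equiv.Perm.mul_apply, hprev,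
        pow_succ', Equiv.Perm.mul_apply]
      obtain ⟨h1, h2⟩ := havoid s'' hpos (by omega)
      exact transpose_apply_of_ne σ h1 h2

/-- `transpose σ v u = transpose σ u v`. [folklore] -/
theorem transpose_comm (σ : Equiv.Perm (Fin (2 ^ m))) (u v : Fin (2 ^ m)) :
    transpose σ v u = transpose σ u v := by
  simp [transpose, Equiv.swap_comm]

/-- **Transpositions at distance `> T` stay in the long-cycle family**: if no point returns
within `T` steps under `σ`, and neither `u` reaches `v` nor `v` reaches `u` within `T` steps of
`σ`, then no point returns within `T` steps under `σ * swap u v`. (Merge type: `u, v` on different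
cycles — the reachability hypotheses are automatic; split type: both pieces of the split cycle are
longer than `T`.) [folklore] -/
theorem noReturn_transpose {σ : Equiv.Perm (Fin (2 ^ m))} (hσ : NoReturn T σ)
    {u v : Fin (2 ^ m)} (hA : ∀ j : ℕ, 1 ≤ j → j ≤ T → (σ ^ j) u ≠ v)
    (hB : ∀ j : ℕ, 1 ≤ j → j ≤ T → (σ ^ j) v ≠ u) : NoReturn T (transpose σ u v) := by
  classical
  -- core statement: first hit at `u`
  have core : ∀ (u v : Fin (2 ^ m)), (∀ j : ℕ, 1 ≤ j → j ≤ T → (σ ^ j) v ≠ u) →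
      ∀ (x : Fin (2 ^ m)) (k j₀ : ℕ), 1 ≤ k → k ≤ T → j₀ < k →
      (∀ j' < j₀, (transpose σ u v ^ j') x ≠ u ∧ (transpose σ u v ^ j') x ≠ v) →
      (transpose σ u v ^ j₀) x = u → (transpose σ u v ^ k) x ≠ x := by
    intro u v hB x k j₀ hk hkT hj₀ havoid hhit heq
    have hxu : (σ ^ j₀) x = u := by
      have h := pow_transpose_eq_of_avoid σ u v x j₀ havoid
      rw [hhit] at h
      exact h.symm
    have hav : ∀ s', 1 ≤ s' → s' ≤ T → (σ ^ s') v ≠ u ∧ (σ ^ s') v ≠ v :=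
      fun s' hs1 hs2 => ⟨hB s' hs1 hs2, hσ v s' hs1 hs2⟩
    have hk' : (transpose σ u v ^ k) x = (σ ^ (k - j₀)) v := by
      have := pow_transpose_after_hit σ hhit (s := T - 1)
        (fun s' h1 h2 => hav s' h1 (by omega)) (k - j₀) (by omega) (by omega)
      rw [show j₀ + (k - j₀) = k by omega] at this
      exact this
    rw [hk'] at heq
    -- σ^(k-j₀) v = x ⇒ σ^k v = σ^j₀ x = u, contradicting hB
    have : (σ ^ k) v = u := by
      rw [← hxu, ← heq, ← Equiv.Perm.mul_apply, ← pow_add, show j₀ + (k - j₀) = k by omega]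
    exact hB k hk hkT this
  intro x k hk hkT heq
  by_cases hav : ∀ j' < k, (transpose σ u v ^ j') x ≠ u ∧ (transpose σ u v ^ j') x ≠ v
  · rw [pow_transpose_eq_of_avoid σ u v x k hav] at heq
    exact hσ x k hk hkT heq
  · push Not at hav
    let P : ℕ → Prop := fun j' => j' < k ∧ ((transpose σ u v ^ j') x = u ∨ (transpose σ u v ^ j') x = v)
    have hex : ∃ j', P j' := by
      obtain ⟨j', hj', h⟩ := hav
      by_cases hu : (transpose σ u v ^ j') x = u
      · exact ⟨j', hj', Or.inl hu⟩
      · exact ⟨j', hj', Or.inr (h hu)⟩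
    let j₀ := Nat.find hex
    have hj₀ : P j₀ := Nat.find_spec hex
    have hmin : ∀ j' < j₀, ¬ P j' := fun j' hj' => Nat.find_min hex hj'
    have havoid : ∀ j' < j₀, (transpose σ u v ^ j') x ≠ u ∧ (transpose σ u v ^ j') x ≠ v := by
      intro j' hj'
      have h := hmin j' hj'
      simp only [P, not_and_or, not_or] at h
      rcases h with h | h
      · exact absurd (lt_trans hj' hj₀.1) h
      · exact h
    rcases hj₀.2 with hu | hv
    · exact core u v hB x k j₀ hk hkT hj₀.1 havoid hu heq
    · have havoid' : ∀ j' < j₀, (transpose σ v u ^ j') x ≠ v ∧ (transpose σ v u ^ j') x ≠ u := by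
        intro j' hj'; rw [transpose_comm]; exact ⟨(havoid j' hj').2, (havoid j' hj').1⟩
      have hv' : (transpose σ v u ^ j₀) x = v := by rw [transpose_comm]; exact hv
      have heq' : (transpose σ v u ^ k) x = x := by rw [transpose_comm]; exact heq
      exact core v u hA x k j₀ hk hkT hj₀.1 havoid' hv' heq'

/-- **Merges stay in the long-cycle family**: `u, v` on different cycles of `σ`. [folklore] -/
theorem noReturn_transpose_of_not_sameCycle {σ : Equiv.Perm (Fin (2 ^ m))} (hσ : NoReturn T σ)
    {u v : Fin (2 ^ m)} (huv : ¬ σ.SameCycle u v) : NoReturn T (transpose σ u v) := by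
  refine noReturn_transpose hσ (fun j _ _ h => huv ?_) (fun j _ _ h => huv ?_)
  · exact ⟨(j : ℤ), by rw [zpow_natCast]; exact h⟩
  · exact ⟨-(j : ℤ), by rw [zpow_neg, zpow_natCast, Equiv.Perm.inv_eq_iff_eq]; exact h.symm⟩

end Summit.QuantumAdvantage.QuantumAdvantage.Theorems.WbwVerifiableLineNoSpeedup.Negative.PermInstances
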